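import Literature.RepresentationTheory.TwistedCoinvariantsIrreducible
import Literature.RepresentationTheory.Liu2021.LocalOscillatorDatumOfCentralChar
import Literature.NumberTheory.Automorphic.SmoothRepresentation
import HarnessLib

/-!
# The maximal `χ`-quotient in its two tree forms: `CentralCharacterQuotient.quotRep` = `TwistedCoinv.rep`

Topic `RepresentationTheory`.  Theorems only (no definition, no record, no named fact, no `sorry`).

The tree carries [Liu2021, App. D §D.1 Step 3 (l. 5221)]'s «maximal quotient of `ω` on which the centre acts by `χ`» in
two currencies: `CentralCharacterQuotient.quotRep ρ hζ χ` on `V ⧸ augmentation ρ ζ χ`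
(`augmentation = ⨆_z range (ρ(ζ z) − χ z • id)`; the carrier of the as-printed LOCAL record `LemD1Data.datum` /
`LocalOscillatorDatum.IrreducibleAdmissible`, `Liu2021/LemD1AsPrinted.lean`) and `TwistedCoinv.rep χ ρ hc` on
`Coinv (ρ ∘ ζ) χ = V ⧸ span {ρ(ζ z) v − χ z • v}` (the carrier of the GLOBAL `⊗'` files
`GelbartRogawski1991/FiniteAdelicWeilCentralCoinvariants{,Irreducible}.lean` and of the Hodge/COR-CM lane's
`Def411WeilCarriers`).  This file identifies them:

* `augmentation_eq_ker` — the two relation submodules coincide;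
* `isIrreducible_quotRep_iff`, `nontrivial_quotRep_iff` — irreducibility / non-vanishing transfer (along
  `Submodule.quotEquivOfEq`, `Representation.isIrreducible_iff_of_equivariant`);
* `Representation.IsSmooth.of_equivariant`, `Representation.IsAdmissible.of_equivariant` — GENERIC: smoothness and
  admissibility are transported along an equivariant linear equivalence (same topological group);
  hence `isAdmissible_quotRep_iff`;
* §4 `Representation.IsSmooth.of_equivariant_mulEquiv`, `Representation.IsAdmissible.of_equivariant_mulEquiv` — the same
  transport over a topological group ISOMORPHISM `f : G ≃ₜ* G'` (`e (ρ g v) = ρ' (f g) (e v)`), for moving admissibility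
  between two presentations of one local group (e.g. `U(V)(F_v) ≤ GL_n(E ⊗ F_v)` and `Π_{w∣v} GL_n(E_w)`);
* `irreducibleAdmissible_iff_twistedCoinv` — for a `LocalOscillatorDatum` built by `ofCentralChar`, the record
  `IrreducibleAdmissible` (`IsAdmissible ∧ (Nontrivial → IsIrreducible) ∧ (rank ≠ 2 → Nontrivial)`) read on
  `TwistedCoinv.rep`.

So a consumer holding [Liu2021, Lem. D.1 (1)] in the as-printed local currency can feed the local hypotheses of
`Liu2021/Def411WeilCarriersIrreducibleOfLemD1.lean` (stated on `TwistedCoinv.rep`).  Nothing of [Liu2021] is asserted.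

## References
* [Liu2021] Y. Liu, Camb. J. Math. 9 (2021) = arXiv:2102.11518, App. D §D.1 Step 3 (l. 5221), Lem. D.1 (l. 5226–5229).
* [BernsteinZelevinsky1976] I. N. Bernstein, A. V. Zelevinsky, Russian Math. Surveys 31 (1976), Def. 2.1 (smooth /
  admissible representations).
-/

noncomputable section

/-! ## §1 Smoothness and admissibility along an equivariant linear equivalence -/

namespace Representation

variable {k G V V' : Type*} [CommRing k] [Group G] [TopologicalSpace G] [AddCommGroup V] [Module k V]
  [AddCommGroup V'] [Module k V']

omit [TopologicalSpace G] in
/-- the stabiliser of `e v` under `ρ'` is the stabiliser of `v` under `ρ` for `e` equivariant.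
[cite: BernsteinZelevinsky1976, §2.1] -/
theorem stabilizerSubgroup_equivariant (ρ : Representation k G V) (ρ' : Representation k G V') (e : V ≃ₗ[k] V')
    (he : ∀ g v, e (ρ g v) = ρ' g (e v)) (v : V) :
    ρ'.stabilizerSubgroup (e v) = ρ.stabilizerSubgroup v := by
  ext g
  rw [mem_stabilizerSubgroup, mem_stabilizerSubgroup, ← he, e.injective.eq_iff]

/-- **smoothness is transported along an equivariant linear equivalence.** [cite: BernsteinZelevinsky1976, Definition 2.1(b)] -/
theorem IsSmooth.of_equivariant {ρ : Representation k G V} (ρ' : Representation k G V') (e : V ≃ₗ[k] V')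
    (he : ∀ g v, e (ρ g v) = ρ' g (e v)) (h : ρ.IsSmooth) : ρ'.IsSmooth := fun v' => by
  obtain ⟨v, rfl⟩ := e.surjective v'
  rw [isSmoothVector_iff, stabilizerSubgroup_equivariant ρ ρ' e he v]
  exact h v

omit [TopologicalSpace G] in
/-- the `K`-fixed vectors correspond under an equivariant linear equivalence. [cite: BernsteinZelevinsky1976, Definition 2.1(b)] -/
theorem fixedPoints_map_equivariant (ρ : Representation k G V) (ρ' : Representation k G V') (e : V ≃ₗ[k] V')
    (he : ∀ g v, e (ρ g v) = ρ' g (e v)) (K : Subgroup G) :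
    (ρ.fixedPoints K).map (e : V →ₗ[k] V') = ρ'.fixedPoints K := by
  ext v'
  constructor
  · rintro ⟨v, hv, rfl⟩
    rw [SetLike.mem_coe, mem_fixedPoints] at hv
    rw [mem_fixedPoints]
    intro g hg
    rw [LinearEquiv.coe_coe, ← he, hv g hg]
  · intro hv'
    rw [mem_fixedPoints] at hv'
    refine ⟨e.symm v', ?_, e.apply_symm_apply v'⟩
    rw [SetLike.mem_coe, mem_fixedPoints]
    intro g hg
    apply e.injective
    rw [he, e.apply_symm_apply, hv' g hg]

/-- **admissibility is transported along an equivariant linear equivalence** (same topological group).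
[cite: BernsteinZelevinsky1976, Definition 2.1(b)] -/
theorem IsAdmissible.of_equivariant {ρ : Representation k G V} (ρ' : Representation k G V') (e : V ≃ₗ[k] V')
    (he : ∀ g v, e (ρ g v) = ρ' g (e v)) (h : ρ.IsAdmissible) : ρ'.IsAdmissible := by
  refine ⟨h.isSmooth.of_equivariant ρ' e he, fun K hK => ?_⟩
  haveI := h.finite_fixedPoints K hK
  rw [← fixedPoints_map_equivariant ρ ρ' e he (K : Subgroup G)]
  exact Module.Finite.map _ _

/-- hence admissibility is INVARIANT under an equivariant linear equivalence. [cite: BernsteinZelevinsky1976, Definition 2.1(b)] -/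
theorem isAdmissible_iff_of_equivariant (ρ : Representation k G V) (ρ' : Representation k G V') (e : V ≃ₗ[k] V')
    (he : ∀ g v, e (ρ g v) = ρ' g (e v)) : ρ.IsAdmissible ↔ ρ'.IsAdmissible :=
  ⟨IsAdmissible.of_equivariant ρ' e he, IsAdmissible.of_equivariant ρ e.symm fun g v' => by
    apply e.injective
    rw [he, e.apply_symm_apply, e.apply_symm_apply]⟩

end Representation

/-! ## §2 `quotRep` versus `TwistedCoinv.rep` -/

namespace Literature.RepresentationTheory.TwistedCoinv

open Literature.RepresentationTheory.CentralCharacterQuotient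

variable {k : Type*} [Field k] {G Z V : Type*} [Group G] [Group Z] [AddCommGroup V] [Module k V]
  (ρ : Representation k G V) (ζ : Z →* G) (hζ : ∀ z, ζ z ∈ Subgroup.center G) (χ : Z →* kˣ)

/-- **the two relation submodules coincide**: `augmentation ρ ζ χ = TwistedCoinv.ker (ρ ∘ ζ) χ`
(both are spanned by the vectors `ρ(ζ z) v − χ z • v`). [cite: Liu2021, App. D §D.1 Step 3 (l. 5221)] -/
theorem augmentation_eq_ker : augmentation ρ ζ χ = ker (show Representation k Z V from ρ.comp ζ) χ := by
  refine le_antisymm (iSup_le fun z => ?_) ?_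
  · rintro _ ⟨v, rfl⟩
    exact sub_mem_ker (show Representation k Z V from ρ.comp ζ) χ z v
  · rw [ker, Submodule.span_le]
    rintro _ ⟨⟨z, v⟩, rfl⟩
    exact sub_smul_mem_augmentation ρ ζ χ z v

include hζ in
/-- the operators of `ρ` commute with those of the central `ρ ∘ ζ`. [cite: Liu2021, App. D §D.1 Step 3 (l. 5221)] -/
theorem commute_of_central (g : G) (z : Z) : Commute (ρ g) ((show Representation k Z V from ρ.comp ζ) z) := by
  change Commute (ρ g) (ρ (ζ z))
  rw [Commute, SemiconjBy, ← map_mul, ← map_mul, (Subgroup.mem_center_iff.mp (hζ z) g)]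

/-- **`quotRep` and `TwistedCoinv.rep` are the same representation** along `Submodule.quotEquivOfEq`:
equivariance on classes. [cite: Liu2021, App. D §D.1 Step 3 (l. 5221)] -/
theorem quotEquivOfEq_quotRep (g : G) (x : V ⧸ augmentation ρ ζ χ) :
    Submodule.quotEquivOfEq _ _ (augmentation_eq_ker ρ ζ χ) (quotRep ρ hζ χ g x) =
      rep χ ρ (commute_of_central ρ ζ hζ) g (Submodule.quotEquivOfEq _ _ (augmentation_eq_ker ρ ζ χ) x) := by
  refine Submodule.Quotient.induction_on _ x fun v => ?_
  rfl

/-- **irreducibility transfers**: `quotRep ρ hζ χ` is irreducible iff `TwistedCoinv.rep χ ρ _` is.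
[cite: Liu2021, App. D Lemma D.1, arXiv p. 56] -/
theorem isIrreducible_quotRep_iff (hc : ∀ (g : G) (z : Z), Commute (ρ g) ((show Representation k Z V from ρ.comp ζ) z)) :
    (quotRep ρ hζ χ).IsIrreducible ↔ (rep χ ρ hc).IsIrreducible :=
  Representation.isIrreducible_iff_of_equivariant _ _ (MonoidHom.id G) Function.surjective_id
    (Submodule.quotEquivOfEq _ _ (augmentation_eq_ker ρ ζ χ)) fun g x => quotEquivOfEq_quotRep ρ ζ hζ χ g x

/-- **non-vanishing transfers.** [cite: Liu2021, App. D Lemma D.1, arXiv p. 56] -/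
theorem nontrivial_quotRep_iff :
    Nontrivial (V ⧸ augmentation ρ ζ χ) ↔ Nontrivial (Coinv (show Representation k Z V from ρ.comp ζ) χ) :=
  (Submodule.quotEquivOfEq _ _ (augmentation_eq_ker ρ ζ χ)).toEquiv.nontrivial_congr

/-- **admissibility transfers** (for a topological `G`). [cite: Liu2021, App. D Lemma D.1, arXiv p. 56] -/
theorem isAdmissible_quotRep_iff [TopologicalSpace G]
    (hc : ∀ (g : G) (z : Z), Commute (ρ g) ((show Representation k Z V from ρ.comp ζ) z)) :
    (quotRep ρ hζ χ).IsAdmissible ↔ (rep χ ρ hc).IsAdmissible :=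
  Representation.isAdmissible_iff_of_equivariant _ _ (Submodule.quotEquivOfEq _ _ (augmentation_eq_ker ρ ζ χ))
    fun g x => quotEquivOfEq_quotRep ρ ζ hζ χ g x

end Literature.RepresentationTheory.TwistedCoinv

/-! ## §3 The record `LocalOscillatorDatum.IrreducibleAdmissible` read on `TwistedCoinv.rep` -/

namespace Literature.RepresentationTheory.Liu2021.LocalOscillatorDatum

open Literature.RepresentationTheory Literature.RepresentationTheory.CentralCharacterQuotient

variable {G Z V : Type*} [Group G] [TopologicalSpace G] [CommGroup Z] [AddCommGroup V] [Module ℂ V]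
  (ω : Representation ℂ G V) (ζ : Z →* G) (hζ : ∀ z, ζ z ∈ Subgroup.center G) (χ : Z →* ℂˣ) (n : ℕ) (hn : 2 ≤ n)

/-- **[Liu2021, Lem. D.1 (1)]'s record shape on `TwistedCoinv.rep`**: for the datum `ofCentralChar ω ζ hζ χ n hn`,
`IrreducibleAdmissible` holds iff the `G`-action `TwistedCoinv.rep χ ω _` on `Coinv (ω ∘ ζ) χ` is admissible, irreducible
when non-zero, and non-zero when `n ≠ 2`. [cite: Liu2021, App. D Lemma D.1, arXiv p. 56] -/
theorem irreducibleAdmissible_ofCentralChar_iff_twistedCoinv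
    (hc : ∀ (g : G) (z : Z), Commute (ω g) ((show Representation ℂ Z V from ω.comp ζ) z)) :
    (ofCentralChar ω ζ hζ χ n hn).IrreducibleAdmissible ↔
      ((TwistedCoinv.rep χ ω hc).IsAdmissible ∧
        (Nontrivial (TwistedCoinv.Coinv (show Representation ℂ Z V from ω.comp ζ) χ) →
          (TwistedCoinv.rep χ ω hc).IsIrreducible) ∧
        (n ≠ 2 → Nontrivial (TwistedCoinv.Coinv (show Representation ℂ Z V from ω.comp ζ) χ))) := by
  rw [irreducibleAdmissible_ofCentralChar_iff, TwistedCoinv.isAdmissible_quotRep_iff ω ζ hζ χ hc,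
    TwistedCoinv.isIrreducible_quotRep_iff ω ζ hζ χ hc, TwistedCoinv.nontrivial_quotRep_iff ω ζ χ]

end Literature.RepresentationTheory.Liu2021.LocalOscillatorDatum


/-! ## §4 (append) Smoothness and admissibility along an equivariant linear equivalence OVER A TOPOLOGICAL GROUP ISOMORPHISM -/

namespace Representation

variable {k G G' V V' : Type*} [CommRing k] [Group G] [TopologicalSpace G] [Group G'] [TopologicalSpace G']
  [AddCommGroup V] [Module k V] [AddCommGroup V'] [Module k V']

omit [TopologicalSpace G] [TopologicalSpace G'] in
/-- the stabiliser of `e v` under `ρ'` is the image under `f` of the stabiliser of `v` under `ρ`, for `e` equivariant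
over the group isomorphism `f`. [cite: BernsteinZelevinsky1976, §2.1] -/
theorem stabilizerSubgroup_equivariant_mulEquiv (ρ : Representation k G V) (ρ' : Representation k G' V') (f : G ≃* G')
    (e : V ≃ₗ[k] V') (he : ∀ g v, e (ρ g v) = ρ' (f g) (e v)) (v : V) :
    ρ'.stabilizerSubgroup (e v) = (ρ.stabilizerSubgroup v).map f.toMonoidHom := by
  ext g'
  rw [mem_stabilizerSubgroup, Subgroup.mem_map]
  constructor
  · intro hg'
    refine ⟨f.symm g', ?_, f.apply_symm_apply g'⟩
    rw [mem_stabilizerSubgroup]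
    apply e.injective
    rw [he, f.apply_symm_apply, hg']
  · rintro ⟨g, hg, rfl⟩
    rw [mem_stabilizerSubgroup] at hg
    rw [MulEquiv.coe_toMonoidHom, ← he, hg]

/-- **smoothness is transported along an equivariant linear equivalence over a topological group isomorphism.**
[cite: BernsteinZelevinsky1976, Definition 2.1(b)] -/
theorem IsSmooth.of_equivariant_mulEquiv {ρ : Representation k G V} (ρ' : Representation k G' V') (f : G ≃ₜ* G')
    (e : V ≃ₗ[k] V') (he : ∀ g v, e (ρ g v) = ρ' (f g) (e v)) (h : ρ.IsSmooth) : ρ'.IsSmooth := fun v' => by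
  obtain ⟨v, rfl⟩ := e.surjective v'
  rw [isSmoothVector_iff, stabilizerSubgroup_equivariant_mulEquiv ρ ρ' f.toMulEquiv e he v, Subgroup.coe_map]
  exact f.isOpenMap _ (h v)

omit [TopologicalSpace G] [TopologicalSpace G'] in
/-- the `f(K)`-fixed vectors of `ρ'` are the image of the `K`-fixed vectors of `ρ`. [cite: BernsteinZelevinsky1976, Definition 2.1(b)] -/
theorem fixedPoints_map_equivariant_mulEquiv (ρ : Representation k G V) (ρ' : Representation k G' V') (f : G ≃* G')
    (e : V ≃ₗ[k] V') (he : ∀ g v, e (ρ g v) = ρ' (f g) (e v)) (K : Subgroup G) :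
    (ρ.fixedPoints K).map (e : V →ₗ[k] V') = ρ'.fixedPoints (K.map f.toMonoidHom) := by
  ext v'
  constructor
  · rintro ⟨v, hv, rfl⟩
    rw [SetLike.mem_coe, mem_fixedPoints] at hv
    rw [mem_fixedPoints]
    rintro _ ⟨g, hg, rfl⟩
    rw [MulEquiv.coe_toMonoidHom, LinearEquiv.coe_coe, ← he, hv g hg]
  · intro hv'
    rw [mem_fixedPoints] at hv'
    refine ⟨e.symm v', ?_, e.apply_symm_apply v'⟩
    rw [SetLike.mem_coe, mem_fixedPoints]
    intro g hg
    apply e.injective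
    rw [he, e.apply_symm_apply, hv' (f g) ⟨g, hg, rfl⟩]

/-- **admissibility is transported along an equivariant linear equivalence over a topological group isomorphism**
(`K' ≤ G'` compact open ⇒ `f⁻¹(K')` compact open and `V'^{K'} = e(V^{f⁻¹ K'})`).
[cite: BernsteinZelevinsky1976, Definition 2.1(b)] -/
theorem IsAdmissible.of_equivariant_mulEquiv {ρ : Representation k G V} (ρ' : Representation k G' V') (f : G ≃ₜ* G')
    (e : V ≃ₗ[k] V') (he : ∀ g v, e (ρ g v) = ρ' (f g) (e v)) (h : ρ.IsAdmissible) : ρ'.IsAdmissible := by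
  refine ⟨h.isSmooth.of_equivariant_mulEquiv ρ' f e he, fun K' hK' => ?_⟩
  -- `K := f⁻¹(K')`, compact open in `G`
  let K : OpenSubgroup G := ⟨(K' : Subgroup G').comap f.toMulEquiv.toMonoidHom, K'.isOpen.preimage f.continuous⟩
  have hKc : IsCompact (K : Set G) := by
    have : (K : Set G) = f.symm '' (K' : Set G') := by
      ext g
      constructor
      · intro hg
        exact ⟨f g, hg, f.symm_apply_apply g⟩
      · rintro ⟨g', hg', rfl⟩
        change f (f.symm g') ∈ (K' : Subgroup G')
        rw [ContinuousMulEquiv.apply_symm_apply]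
        exact hg'
    rw [this]
    exact hK'.image f.symm.continuous
  haveI := h.finite_fixedPoints K hKc
  have hmap : ((K : Subgroup G).map f.toMulEquiv.toMonoidHom) = (K' : Subgroup G') := by
    ext g'
    rw [Subgroup.mem_map]
    constructor
    · rintro ⟨g, hg, rfl⟩
      exact hg
    · intro hg'
      refine ⟨f.symm g', ?_, ?_⟩
      · change f (f.symm g') ∈ (K' : Subgroup G')
        rw [ContinuousMulEquiv.apply_symm_apply]
        exact hg'
      · exact f.apply_symm_apply g'
  rw [← hmap, ← fixedPoints_map_equivariant_mulEquiv ρ ρ' f.toMulEquiv e he (K : Subgroup G)]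
  exact Module.Finite.map _ _

end Representation

end
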